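import Summits.NavierStokesRegularity.FluidComputer.LerayClock
import Summits.NavierStokesRegularity.FluidComputer.CriticalLevels
import HarnessLib

/-!
# Fluid computer — the level dictionary, LOCALISATION FACE (L33): the blow-up is confined to a fixed ball,
# has a singular point, and the critical divergence is local

HONEST FRAMING (cell `pub-fluidc`, verbatim): *low prior, high value-of-information experiment on Tao's
machine paradigm; NOT a claim that NS blows up.* Theorem side of the cell; nothing here is evidence of blow-up.
The faces so far are GLOBAL in space (norms over `ℝ³`, sums over all blocks). The far-field ε-regularity of
the tree (`SereginSverak2002.farField_bound`: a classical Leray–Hopf solution is bounded for `t ∈ (δ, T)`,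
`|x| > R`; Lemarié-Rieusset 2016 Thm. 14.5 via Caffarelli–Kohn–Nirenberg, PROVED in the tree) localises them. For
every maximal smooth solution `(u, p)` of the unforced Navier–Stokes system on `ℝ³ × [0, T)` (`ν > 0`) which is
Leray–Hopf from `u 0`:

* `exists_ball_rate` (**L33 — LERAY'S RATE IS ATTAINED INSIDE A FIXED BALL**): with the absolute `c` of the sup
  clock (L21), there are `R ≥ 0` and `t₁ < T` such that for every `t ∈ (t₁, T)` some point `x` with `|x| ≤ R` has
  `|u(t, x)| ≥ c√ν/√(T − t)`; outside the ball `B̄(0, R)` the solution stays bounded on `(T/2, T)`.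
* `exists_singularPoint` (**L33′ — A SINGULAR POINT**): there is `x₀` (with `|x₀| ≤ R`) such that `u` is unbounded
  on EVERY backward parabolic neighbourhood `(T − r², T) × B(x₀, r)`, `r > 0` — the blow-up happens AT A POINT
  (compactness of `B̄(0, R)` and L33).
* `exists_ball_eLpNorm_three_tendsto_top` (**L33″ — THE CRITICAL DIVERGENCE IS LOCAL**): there is `R` with
  `‖u(t)‖_{L³(B̄(0,R))} → ∞` as `t ↑ T` — outside the ball `∫|u|³ ≤ M ‖u(0)‖₂²` stays bounded (far-field bound ×
  energy), so all of the divergence of L27 sits inside the ball.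

Reading for the machine paradigm (words): a finite-energy blow-up on `ℝ³` has a spatial FOCUS — a bounded region
carrying Leray's rate and the divergent critical mass, and inside it a point every parabolic neighbourhood of which
sees unbounded velocity; the far field is tame. (For the cell's periodic designs the analogue is the existence of a
blow-up point; the dictionary's class is `ℝ³`.) Qualitative; `R`, `t₁`, `x₀` depend on the solution. Necessity
only. 0 sorry; no new definitions, no named facts.

## References

* P. G. Lemarié-Rieusset, *The Navier–Stokes Problem in the 21st Century*, CRC 2016, Thm. 14.4, Thm. 14.5 (proof,
  p. 512). [LemarieRieusset2016]
* L. Caffarelli, R. Kohn, L. Nirenberg, Comm. Pure Appl. Math. 35 (1982) 771–831. [CKN1982]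
* J. Leray, Acta Math. 63 (1934) 193–248, §19. [Leray1934]
* G. Seregin, Comm. Math. Phys. 312 (2012) 833–845, Thm. 1.1. [Seregin2012]
-/

noncomputable section

open MeasureTheory Set Function Filter Topology Metric
open scoped ENNReal NNReal
open Literature.Analysis.FluidPDE Literature.Analysis.FunctionSpaces
open Summit.NavierStokesRegularity.FluidComputer.LeraySupClock
open Summit.NavierStokesRegularity.FluidComputer.CriticalDivergence
open Summit.NavierStokesRegularity.FluidComputer.CriticalLevels

namespace Summit.NavierStokesRegularity.FluidComputer.LocalisationFace

/-! ## L33: Leray's rate is attained inside a fixed ball -/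

/-- **L33 — THE BLOW-UP IS CONFINED TO A FIXED BALL.** With the absolute constant `c > 0` of the sup clock
(`LeraySupClock.supNorm_clock`): for every `ν > 0`, `T > 0` and every maximal smooth solution `(u, p)` of the
unforced Navier–Stokes system on `ℝ³ × [0, T)` which is Leray–Hopf from `u 0`, there are a radius `R ≥ 0`, a bound
`M` and a time `t₁ ∈ [T/2, T)` such that (i) `‖u(t, x)‖ ≤ M` for all `t ∈ (T/2, T)` and `‖x‖ > R` (far-field
ε-regularity, `SereginSverak2002.farField_bound`), and (ii) for every `t ∈ (t₁, T)` some `x` with `‖x‖ ≤ R` carries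
Leray's rate: `c√ν/√(T − t) ≤ ‖u(t, x)‖` (the sup clock against the far-field bound; the maximum over the compact
ball is attained). [cite: LemarieRieusset2016, proof of Thm. 14.5 (p. 512) with Thm. 14.4 (p. 505)]
[cite: Leray1934, §19 (3.8)–(3.9) p. 224] -/
theorem exists_ball_rate :
    ∃ c : ℝ, 0 < c ∧ ∀ (ν T : ℝ), 0 < ν → 0 < T →
      ∀ (u : ℝ → EuclideanSpace ℝ (Fin 3) → EuclideanSpace ℝ (Fin 3)) (p : ℝ → EuclideanSpace ℝ (Fin 3) → ℝ),
      IsMaximalSmoothSolution ν 0 u p T → IsLerayHopfOn T ν 0 (u 0) u →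
      ∃ R M t₁ : ℝ, 0 ≤ R ∧ T / 2 ≤ t₁ ∧ t₁ < T ∧
        (∀ t ∈ Ioo (T / 2) T, ∀ x : EuclideanSpace ℝ (Fin 3), R < ‖x‖ → ‖u t x‖ ≤ M) ∧
        ∀ t ∈ Ioo t₁ T, ∃ x ∈ closedBall (0 : EuclideanSpace ℝ (Fin 3)) R,
          c * Real.sqrt ν / Real.sqrt (T - t) ≤ ‖u t x‖ := by
  obtain ⟨c, hc, H⟩ := supNorm_clock
  refine ⟨c, hc, fun ν T hν hT u p hmax hLH => ?_⟩
  obtain ⟨R₀, M₀, hfar⟩ := SereginSverak2002.farField_bound hν hT hmax.1 hLH (δ := T / 2) (by positivity)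
  -- normalise: `R ≥ 0`, `M ≥ 1`
  set R : ℝ := max R₀ 0 with hR
  set M : ℝ := max M₀ 1 with hM
  have hR0 : 0 ≤ R := le_max_right _ _
  have hM1 : 1 ≤ M := le_max_right _ _
  have hM0 : 0 < M := one_pos.trans_le hM1
  have hfar' : ∀ t ∈ Ioo (T / 2) T, ∀ x : EuclideanSpace ℝ (Fin 3), R < ‖x‖ → ‖u t x‖ ≤ M :=
    fun t ht x hx => (hfar t ht x ((le_max_left _ _).trans_lt hx)).trans (le_max_left _ _)
  -- the time `t₁` after which Leray's rate exceeds `M`: `c√ν/√(T−t) > M` iff `T − t < c²ν/M²`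
  set t₁ : ℝ := max (T / 2) (T - c ^ 2 * ν / M ^ 2 / 2) with ht₁
  have hcν : 0 < c ^ 2 * ν / M ^ 2 := by positivity
  have ht₁T : t₁ < T := max_lt (by linarith) (by linarith)
  refine ⟨R, M, t₁, hR0, le_max_left _ _, ht₁T, hfar', fun t ht => ?_⟩
  have htT2 : T / 2 < t := (le_max_left _ _).trans_lt ht.1
  have hTt : 0 < T - t := sub_pos.2 ht.2
  have hTt' : T - t < c ^ 2 * ν / M ^ 2 := by
    have := (le_max_right _ _).trans_lt ht.1
    linarith
  -- the rate at time `t` exceeds `M`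
  set ρ : ℝ := c * Real.sqrt ν / Real.sqrt (T - t) with hρ
  have hρM : M < ρ := by
    rw [hρ, lt_div_iff₀ (Real.sqrt_pos.2 hTt)]
    have h1 : M * Real.sqrt (T - t) < M * Real.sqrt (c ^ 2 * ν / M ^ 2) :=
      mul_lt_mul_of_pos_left (Real.sqrt_lt_sqrt hTt.le hTt') hM0
    have h2 : Real.sqrt (c ^ 2 * ν / M ^ 2) = c * Real.sqrt ν / M := by
      rw [Real.sqrt_div' _ (by positivity), Real.sqrt_mul (sq_nonneg c), Real.sqrt_sq hc.le,
        Real.sqrt_sq hM0.le]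
    rw [h2, mul_div_cancel₀ _ hM0.ne'] at h1
    exact h1
  -- the maximum of `‖u(t, ·)‖` over the compact ball is attained at some `x₀`
  have hK : IsCompact (closedBall (0 : EuclideanSpace ℝ (Fin 3)) R) := isCompact_closedBall _ _
  have hcu : Continuous (u t) := (hmax.1.contDiff_velocity ⟨by linarith, ht.2⟩).continuous
  obtain ⟨x₀, hx₀, hmax₀⟩ := hK.exists_isMaxOn ⟨0, mem_closedBall_self hR0⟩ hcu.norm.continuousOn
  refine ⟨x₀, hx₀, ?_⟩
  by_contra hlt
  rw [not_le] at hlt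
  -- then `‖u(t, x)‖ ≤ max M ‖u(t, x₀)‖ < ρ` everywhere, contradicting the sup clock
  set B : ℝ := max M ‖u t x₀‖ with hB
  have hBρ : B < ρ := max_lt hρM hlt
  have hbound : ∀ x, ‖u t x‖ ≤ B := by
    intro x
    rcases le_or_gt ‖x‖ R with hx | hx
    · exact (hmax₀ (mem_closedBall_zero_iff.2 hx)).trans (le_max_right _ _)
    · exact (hfar' t ⟨htT2, ht.2⟩ x hx).trans (le_max_left _ _)
  have hsup : eLpNorm (u t) ∞ volume ≤ ENNReal.ofReal B := by
    rw [eLpNorm_exponent_top]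
    exact eLpNormEssSup_le_of_ae_bound (Eventually.of_forall hbound)
  have hclock := H ν T hν hT u p hmax hLH t ⟨by linarith, ht.2⟩
  have : ENNReal.ofReal ρ ≤ ENNReal.ofReal B := hclock.trans hsup
  rw [ENNReal.ofReal_le_ofReal_iff (hM0.le.trans (le_max_left _ _))] at this
  exact absurd (this.trans_lt hBρ) (lt_irrefl _)

/-! ## L33′: a singular point -/

/-- **L33′ — THE BLOW-UP HAS A SINGULAR POINT.** For every `ν > 0`, `T > 0` and every maximal smooth solution
`(u, p)` of the unforced Navier–Stokes system on `ℝ³ × [0, T)` which is Leray–Hopf from `u 0`, there is a point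
`x₀ ∈ ℝ³` such that `u` is unbounded on EVERY backward parabolic neighbourhood of `(T, x₀)`: for every `r > 0` and
every `M` there are `t ∈ (T − r², T)`, `t > 0`, and `x` with `‖x − x₀‖ < r` and `‖u(t, x)‖ > M`. Proof: if every
point of the ball `B̄(0, R)` of `exists_ball_rate` had a bounded parabolic neighbourhood, finitely many of them would
cover the ball (compactness) and bound `u` near `T` on it, against L33.
[cite: LemarieRieusset2016, proof of Thm. 14.5 (p. 512)] [cite: Leray1934, §19 (3.8)–(3.9) p. 224] -/
theorem exists_singularPoint {ν T : ℝ} (hν : 0 < ν) (hT : 0 < T)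
    {u : ℝ → EuclideanSpace ℝ (Fin 3) → EuclideanSpace ℝ (Fin 3)} {p : ℝ → EuclideanSpace ℝ (Fin 3) → ℝ}
    (hmax : IsMaximalSmoothSolution ν 0 u p T) (hLH : IsLerayHopfOn T ν 0 (u 0) u) :
    ∃ x₀ : EuclideanSpace ℝ (Fin 3), ∀ r : ℝ, 0 < r → ∀ M : ℝ,
      ∃ t ∈ Ioo (T - r ^ 2) T, 0 < t ∧ ∃ x ∈ ball x₀ r, M < ‖u t x‖ := by
  obtain ⟨c, hc, H⟩ := exists_ball_rate
  obtain ⟨R, -, t₁, hR0, ht₁2, ht₁T, -, hrate⟩ := H ν T hν hT u p hmax hLH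
  by_contra hno
  push Not at hno
  -- every point has a bounded parabolic neighbourhood: radius `r x`, bound `B x`
  choose r hr B hB using hno
  -- finitely many of the balls `B(x, r x)` cover the compact ball `B̄(0, R)`
  have hK : IsCompact (closedBall (0 : EuclideanSpace ℝ (Fin 3)) R) := isCompact_closedBall _ _
  obtain ⟨F, hF⟩ := hK.elim_finite_subcover (fun x => ball x (r x)) (fun _ => isOpen_ball)
    (fun x _ => mem_iUnion.2 ⟨x, mem_ball_self (hr x)⟩)
  have hFne : F.Nonempty := by
    have h0 : (0 : EuclideanSpace ℝ (Fin 3)) ∈ ⋃ x ∈ F, ball x (r x) := hF (mem_closedBall_self hR0)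
    obtain ⟨x, hx, -⟩ := mem_iUnion₂.1 h0
    exact ⟨x, hx⟩
  -- a common radius and a common bound over the finite cover
  obtain ⟨x₁, hx₁, hrmin⟩ := F.exists_min_image (fun x => r x) hFne
  obtain ⟨x₂, hx₂, hBmax⟩ := F.exists_max_image (fun x => B x) hFne
  set r₀ : ℝ := r x₁ with hr₀
  have hr₀pos : 0 < r₀ := hr x₁
  set B₀ : ℝ := max (B x₂) 0 + 1 with hB₀
  have hB₀pos : 0 < B₀ := by rw [hB₀]; linarith [le_max_right (B x₂) 0]
  -- a time late enough: inside the parabolic window of every ball of the cover, past `t₁`, rate above `B₀`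
  set t : ℝ := max (max t₁ (T - r₀ ^ 2 / 2)) (T - c ^ 2 * ν / B₀ ^ 2 / 2) with htdef
  have hc2 : 0 < c ^ 2 * ν / B₀ ^ 2 := by positivity
  have htT : t < T := max_lt (max_lt ht₁T (by nlinarith [hr₀pos])) (by linarith)
  have ht₁le : t₁ ≤ t := (le_max_left _ _).trans (le_max_left _ _)
  -- use a time strictly between `t` and `T`
  set t' : ℝ := (t + T) / 2 with ht'def
  have ht' : t' ∈ Ioo t₁ T := ⟨by rw [ht'def]; linarith, by rw [ht'def]; linarith⟩
  have ht'pos : 0 < t' := by linarith [ht'.1, ht₁2]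
  have hTt' : 0 < T - t' := sub_pos.2 ht'.2
  have hwin : ∀ x ∈ F, t' ∈ Ioo (T - r x ^ 2) T := by
    intro x hx
    refine ⟨?_, ht'.2⟩
    have h1 : r₀ ≤ r x := hrmin x hx
    have h2 : T - r₀ ^ 2 / 2 ≤ t := (le_max_right _ _).trans (le_max_left _ _)
    have h3 : r₀ ^ 2 ≤ r x ^ 2 := pow_le_pow_left₀ hr₀pos.le h1 2
    rw [ht'def]
    nlinarith
  have hrateB : B₀ < c * Real.sqrt ν / Real.sqrt (T - t') := by
    have hlt : T - t' < c ^ 2 * ν / B₀ ^ 2 := by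
      have := le_max_right (max t₁ (T - r₀ ^ 2 / 2)) (T - c ^ 2 * ν / B₀ ^ 2 / 2)
      rw [ht'def]
      linarith
    rw [lt_div_iff₀ (Real.sqrt_pos.2 hTt')]
    have h1 : B₀ * Real.sqrt (T - t') < B₀ * Real.sqrt (c ^ 2 * ν / B₀ ^ 2) :=
      mul_lt_mul_of_pos_left (Real.sqrt_lt_sqrt hTt'.le hlt) hB₀pos
    have h2 : Real.sqrt (c ^ 2 * ν / B₀ ^ 2) = c * Real.sqrt ν / B₀ := by
      rw [Real.sqrt_div' _ (by positivity), Real.sqrt_mul (sq_nonneg c), Real.sqrt_sq hc.le,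
        Real.sqrt_sq hB₀pos.le]
    rw [h2, mul_div_cancel₀ _ hB₀pos.ne'] at h1
    exact h1
  -- the rate is attained at some `x ∈ B̄(0, R)`, which lies in some ball of the cover: contradiction
  obtain ⟨x, hxR, hx⟩ := hrate t' ht'
  obtain ⟨x₃, hx₃F, hx₃⟩ := mem_iUnion₂.1 (hF hxR)
  have hbd : ‖u t' x‖ ≤ B x₃ := hB x₃ t' (hwin x₃ hx₃F) ht'pos x hx₃
  have hBle : B x₃ ≤ B₀ := by
    rw [hB₀]
    linarith [hBmax x₃ hx₃F, le_max_left (B x₂) 0]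
  linarith

/-! ## L33″: the critical divergence is local -/

/-- **L33″ — THE CRITICAL DIVERGENCE SITS INSIDE A FIXED BALL.** For every `ν > 0`, `T > 0` and every maximal
smooth solution `(u, p)` of the unforced Navier–Stokes system on `ℝ³ × [0, T)` which is Leray–Hopf from `u 0`,
there is a radius `R` with `‖u(t)‖_{L³(B̄(0, R))} → ∞` as `t ↑ T`. Outside the ball of `exists_ball_rate` the
solution is bounded by `M` on `(T/2, T)`, so `∫_{|x|>R} |u(t)|³ ≤ M ‖u(t)‖₂² ≤ M ‖u(0)‖₂²` stays bounded, and the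
divergence of `‖u(t)‖_{L³(ℝ³)}` (L27, `CriticalDivergence.eLpNorm_three_tendsto_top`) must come from the ball.
[cite: Seregin2012, Thm. 1.1] [cite: LemarieRieusset2016, proof of Thm. 14.5 (p. 512)] -/
theorem exists_ball_eLpNorm_three_tendsto_top {ν T : ℝ} (hν : 0 < ν) (hT : 0 < T)
    {u : ℝ → EuclideanSpace ℝ (Fin 3) → EuclideanSpace ℝ (Fin 3)} {p : ℝ → EuclideanSpace ℝ (Fin 3) → ℝ}
    (hmax : IsMaximalSmoothSolution ν 0 u p T) (hLH : IsLerayHopfOn T ν 0 (u 0) u) :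
    ∃ R : ℝ, Tendsto (fun t => eLpNorm (u t) 3 (volume.restrict (closedBall (0 : EuclideanSpace ℝ (Fin 3)) R)))
      (𝓝[<] T) (𝓝 ∞) := by
  obtain ⟨c, hc, H⟩ := exists_ball_rate
  obtain ⟨R, M, t₁, hR0, -, -, hfar, -⟩ := H ν T hν hT u p hmax hLH
  have hM0 : 0 ≤ M := by
    -- `M` bounds a norm at some far point at some time in `(T/2, T)`
    obtain ⟨x, hx⟩ : ∃ x : EuclideanSpace ℝ (Fin 3), R < ‖x‖ := by
      obtain ⟨x, hx⟩ := NormedSpace.exists_lt_norm ℝ (EuclideanSpace ℝ (Fin 3)) R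
      exact ⟨x, hx⟩
    exact (norm_nonneg _).trans (hfar ((3 * T) / 4) ⟨by linarith, by linarith⟩ x hx)
  refine ⟨R, ?_⟩
  set K : Set (EuclideanSpace ℝ (Fin 3)) := closedBall 0 R with hK
  have hKm : MeasurableSet K := measurableSet_closedBall
  have hu0 : MemLp (u 0) 2 volume := hLH.memLp 0 ⟨le_rfl, hT.le⟩
  -- the far part of `∫|u(t)|³` is bounded by `H₀ = M ‖u(0)‖₂²`
  set H₀ : ℝ≥0∞ := ENNReal.ofReal M * eLpNorm (u 0) 2 volume ^ 2 with hH₀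
  have hH₀top : H₀ ≠ ⊤ := ENNReal.mul_ne_top ENNReal.ofReal_ne_top (ENNReal.pow_ne_top hu0.eLpNorm_ne_top)
  have hsplit : ∀ᶠ t in 𝓝[<] T, eLpNorm (u t) 3 volume ^ 3 ≤ H₀ + ∫⁻ x in K, ‖u t x‖ₑ ^ 3 := by
    filter_upwards [Ioo_mem_nhdsLT (by linarith : T / 2 < T)] with t ht
    have htI : t ∈ Icc 0 T := ⟨by linarith [ht.1], ht.2.le⟩
    have h3 := eLpNorm_natCast_pow_eq_lintegral volume (u t) (n := 3) (by norm_num)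
    have h2 := eLpNorm_natCast_pow_eq_lintegral volume (u t) (n := 2) (by norm_num)
    simp only [Nat.cast_ofNat] at h3 h2
    rw [h3, ← lintegral_add_compl (μ := volume) (fun x => ‖u t x‖ₑ ^ 3) hKm, add_comm]
    refine add_le_add ?_ le_rfl
    -- on `Kᶜ`: `‖u‖³ ≤ M ‖u‖²`
    calc ∫⁻ x in Kᶜ, ‖u t x‖ₑ ^ 3
        ≤ ∫⁻ x in Kᶜ, ENNReal.ofReal M * ‖u t x‖ₑ ^ 2 := by
          refine setLIntegral_mono' hKm.compl fun x hx => ?_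
          have hxR : R < ‖x‖ := by
            rw [hK, mem_compl_iff, mem_closedBall_zero_iff, not_le] at hx
            exact hx
          have hb : ‖u t x‖ ≤ M := hfar t ht x hxR
          calc ‖u t x‖ₑ ^ 3 = ‖u t x‖ₑ * ‖u t x‖ₑ ^ 2 := by ring
            _ ≤ ENNReal.ofReal M * ‖u t x‖ₑ ^ 2 := by
                refine mul_le_mul' ?_ le_rfl
                rw [← ofReal_norm]
                exact ENNReal.ofReal_le_ofReal hb
      _ = ENNReal.ofReal M * ∫⁻ x in Kᶜ, ‖u t x‖ₑ ^ 2 :=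
          lintegral_const_mul' _ _ ENNReal.ofReal_ne_top
      _ ≤ ENNReal.ofReal M * ∫⁻ x, ‖u t x‖ₑ ^ 2 :=
          mul_le_mul' le_rfl (setLIntegral_le_lintegral _ _)
      _ = ENNReal.ofReal M * eLpNorm (u t) 2 volume ^ 2 := by rw [h2]
      _ ≤ H₀ := by
          rw [hH₀]
          gcongr
          exact hLH.eLpNorm_le_eLpNorm_datum hν.le hu0 htI
  -- `‖u(t)‖₃³ → ∞`, hence the ball integral, hence its cube root
  have h3top : Tendsto (fun t => eLpNorm (u t) 3 volume ^ 3) (𝓝[<] T) (𝓝 ∞) := by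
    have hcont := (ENNReal.continuous_pow 3).tendsto ∞
    rw [ENNReal.top_pow (by norm_num : (3 : ℕ) ≠ 0)] at hcont
    exact hcont.comp (eLpNorm_three_tendsto_top hν hT hmax hLH)
  have hball : Tendsto (fun t => ∫⁻ x in K, ‖u t x‖ₑ ^ 3) (𝓝[<] T) (𝓝 ∞) :=
    tendsto_top_of_le_add hH₀top h3top hsplit
  have hroot := ((ENNReal.continuous_rpow_const (y := (1 / 3 : ℝ))).tendsto ∞).comp hball
  rw [ENNReal.top_rpow_of_pos (by norm_num : (0 : ℝ) < 1 / 3)] at hroot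
  refine hroot.congr fun t => ?_
  have h3 := eLpNorm_natCast_pow_eq_lintegral (volume.restrict K) (u t) (n := 3) (by norm_num)
  simp only [Nat.cast_ofNat] at h3
  simp only [Function.comp_apply]
  rw [← h3, ← ENNReal.rpow_natCast, ← ENNReal.rpow_mul]
  norm_num

end Summit.NavierStokesRegularity.FluidComputer.LocalisationFace

end
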